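import Mathlib
import HarnessLib
import Summits.HubbardSuperconductivity.HubbardSuperconductivity.Theorems.KLProgrammeMatsubaraSlicePropagator

/-!
# Route `KLProgramme` — crux K3 split, ENGINE child (`KLRegimeEngineV7` stmt-HubbardSuperconductivity-19662 and its gen-3 successor):
# the same-slice particle–hole bubble AT TRANSFER `(q₀, δ)` in scale form — zero-sound remainder + thermal term + transfer-Lipschitz term
# (cell gate-hubbard-kl, seat hubbard-kl-k3c2-p2 «thermal-bar induction n ≤ nScales β + 1»)

Continues `…MatsubaraSlicePropagator` (sign-blind sum, generic perturbation, the propagator `Φ_g(k₀,e) = g(k₀²+e²)(ik₀+e)`):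
* §1 the dictionary from the SHELL WEIGHT `f` of the slice (`‖f‖ ≤ M_f`, `L_f`-Lipschitz in `s = t²`, `f(s) = 0` for `s ≤ r₁²`) to the
  singularity-free weight `g = f/s`: `Lip(g) ≤ L_f/r₁² + M_f/r₁⁴` (`klsp_div_lipschitz`), `‖g‖ ≤ M_f/r₁²`, `(f(s)/s)(ik₀+e) = f(s)(−ik₀+e)⁻¹`
  (`klsp_div_propagator_eq`) and the sharp sup `‖f(s)(−ik₀+e)⁻¹‖ ≤ M_f/r₁` (`klsp_div_propagator_norm_le`);
* §2 the SCALE FORM at `n ≤ n_β + 1` (`r₁ = Λ_n/2`, `r = 4Λ_n` — k3c2-p3's `klld_slice_support`; `L_f' ≤ ℓ'/Λ_n²`; frequency-count factor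
  `4Λ_n/π + 3/β ≤ (16/π)Λ_n`, `klsp_count_factor_le`): the TRANSFER PERTURBATION of the same-slice bubble
  `‖β⁻¹ • Σ_i ∫ W(e)·Φ(ω_i,e)·(Ψ(ω_i+q₀, e+δ(e)) − Ψ(ω_i,e)) de‖ ≤ (1024/π)·M_f·(48ℓ' + 193M_f')·B_W·(|q₀| + δ_max)/Λ_n`
  (`klsp_slice_bubble_shift_norm_le`; `Φ, Ψ` the two slice propagators) — the `K·ρ/Λ_n` branch of `phGainOf` with an explicit (crude,
  radial-to-Cartesian) constant; and the FULL BUBBLE AT TRANSFER (`klsp_slice_bubble_transfer_norm_le`) = zero-transfer bubble of the weight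
  product `F = f·f'` (`klte_slice_bubble_weighted_norm_le`: zero-sound remainder `(524288/π)(ℓ_F+8M_F)·L_W·Λ_n` + thermal term
  `(393216/π)(ℓ_F+8M_F)·B_W·(π/β)/Λ_n`) + the perturbation.
With `q₀ = 2π/β` (exchange channel at the reading frequencies) the perturbation is itself thermal-shaped: `(2π/β)/Λ_n ≤ 8·4^{-(n_β−n)}`
(`klte_ratio_le_four_mul_inv_pow`).  Pure analysis; nothing about the model is asserted.
References: DECOMP App. E Lemma E.2 (iii)/(iv)(a); `…ShellGainProfiles` (`phGainOf`); HOME/hubbard-kl-k3c2-p2/THERMAL-NOTE.md §2.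
-/

noncomputable section

namespace Summit.HubbardSuperconductivity.HubbardSuperconductivity.Theorems.KLRegimeSplit

set_option linter.dupNamespace false -- summit = problem name (single-conjunct summit), D-0017

open Real Finset MeasureTheory Complex Literature.MathematicalPhysics.QuantumLattice Literature.Probability.LatticeModels
open Summit.HubbardSuperconductivity.HubbardSuperconductivity.Theorems.KLProgrammeLegKernels

/-! ## §1 From the shell weight `f` to `g = f/s` -/

section Weight

variable {f : ℝ → ℂ} {Lf Mf r₁ r₂ : ℝ}

/-- `‖f(s)/s‖ ≤ M_f/r₁²` when `‖f‖ ≤ M_f` and `f(s) = 0` for `s ≤ r₁²` (`r₁ > 0`). -/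
theorem klsp_div_norm_le (hbd : ∀ s, ‖f s‖ ≤ Mf) (hin : ∀ s, s ≤ r₁ ^ 2 → f s = 0) (hr₁ : 0 < r₁) (s : ℝ) :
    ‖f s / ((s : ℝ) : ℂ)‖ ≤ Mf / r₁ ^ 2 := by
  have hMf : 0 ≤ Mf := (norm_nonneg _).trans (hbd 0)
  rcases le_or_gt s (r₁ ^ 2) with hs | hs
  · rw [hin s hs, zero_div, norm_zero]; positivity
  · have hs0 : 0 < s := lt_trans (by positivity) hs
    rw [norm_div, Complex.norm_real, Real.norm_of_nonneg hs0.le]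
    exact div_le_div₀ hMf (hbd s) (by positivity) hs.le

/-- `f/s` vanishes where `f` does (in particular for `s ≥ r₂²`). -/
theorem klsp_div_zero (hout : ∀ s, r₂ ^ 2 ≤ s → f s = 0) (s : ℝ) (hs : r₂ ^ 2 ≤ s) :
    (fun s : ℝ => f s / ((s : ℝ) : ℂ)) s = 0 := by
  simp only [hout s hs, zero_div]

/-- **`g = f/s` is Lipschitz** with constant `L_f/r₁² + M_f/r₁⁴` when `f` is `L_f`-Lipschitz, `‖f‖ ≤ M_f`, and `f(s) = 0` for `s ≤ r₁²`
(`r₁ > 0`). -/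
theorem klsp_div_lipschitz (hlip : ∀ s s', ‖f s - f s'‖ ≤ Lf * |s - s'|) (hbd : ∀ s, ‖f s‖ ≤ Mf)
    (hin : ∀ s, s ≤ r₁ ^ 2 → f s = 0) (hr₁ : 0 < r₁) (s s' : ℝ) :
    ‖f s / ((s : ℝ) : ℂ) - f s' / ((s' : ℝ) : ℂ)‖ ≤ (Lf / r₁ ^ 2 + Mf / r₁ ^ 4) * |s - s'| := by
  have hLf : 0 ≤ Lf := by
    have := hlip 0 1; have h0 : (0:ℝ) ≤ ‖f 0 - f 1‖ := norm_nonneg _; norm_num at this; linarith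
  have hMf : 0 ≤ Mf := (norm_nonneg _).trans (hbd 0)
  have hr2 : 0 < r₁ ^ 2 := by positivity
  have hr4 : 0 < r₁ ^ 4 := by positivity
  have hnorm : ∀ t : ℝ, 0 < t → ‖((t : ℝ) : ℂ)‖ = t := fun t ht => by
    rw [Complex.norm_real, Real.norm_of_nonneg ht.le]
  -- one-sided: `s` inside (f s = 0), `s'` outside
  have hmixed : ∀ s s' : ℝ, s ≤ r₁ ^ 2 → r₁ ^ 2 < s' →
      ‖f s / ((s : ℝ) : ℂ) - f s' / ((s' : ℝ) : ℂ)‖ ≤ (Lf / r₁ ^ 2 + Mf / r₁ ^ 4) * |s - s'| := by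
    intro s s' hs hs'
    have hs'0 : 0 < s' := lt_trans hr2 hs'
    rw [hin s hs, zero_div, zero_sub, norm_neg, norm_div, hnorm s' hs'0]
    have h1 : ‖f s'‖ ≤ Lf * |s - s'| := by
      have := hlip s' s
      rw [hin s hs, sub_zero, abs_sub_comm] at this
      exact this
    calc ‖f s'‖ / s' ≤ Lf * |s - s'| / r₁ ^ 2 := div_le_div₀ (by positivity) h1 hr2 hs'.le
      _ = Lf / r₁ ^ 2 * |s - s'| := by ring
      _ ≤ (Lf / r₁ ^ 2 + Mf / r₁ ^ 4) * |s - s'| := by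
          have : 0 ≤ Mf / r₁ ^ 4 * |s - s'| := by positivity
          nlinarith
  by_cases hs : s ≤ r₁ ^ 2 <;> by_cases hs' : s' ≤ r₁ ^ 2
  · rw [hin s hs, hin s' hs', zero_div, zero_div, sub_zero, norm_zero]; positivity
  · exact hmixed s s' hs (not_le.mp hs')
  · have h := hmixed s' s hs' (not_le.mp hs)
    rwa [← norm_neg, neg_sub, abs_sub_comm] at h
  · -- both outside
    push Not at hs hs'
    have hs0 : 0 < s := lt_trans hr2 hs
    have hs'0 : 0 < s' := lt_trans hr2 hs'
    have hsc : ((s : ℝ) : ℂ) ≠ 0 := by exact_mod_cast hs0.ne'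
    have hs'c : ((s' : ℝ) : ℂ) ≠ 0 := by exact_mod_cast hs'0.ne'
    have hsplit : f s / ((s : ℝ) : ℂ) - f s' / ((s' : ℝ) : ℂ) =
        (f s - f s') / ((s : ℝ) : ℂ) + f s' * ((((s : ℝ) : ℂ))⁻¹ - (((s' : ℝ) : ℂ))⁻¹) := by
      field_simp; ring
    rw [hsplit]
    have hA : ‖(f s - f s') / ((s : ℝ) : ℂ)‖ ≤ Lf / r₁ ^ 2 * |s - s'| := by
      rw [norm_div, hnorm s hs0]
      calc ‖f s - f s'‖ / s ≤ Lf * |s - s'| / r₁ ^ 2 := div_le_div₀ (by positivity) (hlip s s') hr2 hs.le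
        _ = Lf / r₁ ^ 2 * |s - s'| := by ring
    have hB : ‖f s' * ((((s : ℝ) : ℂ))⁻¹ - (((s' : ℝ) : ℂ))⁻¹)‖ ≤ Mf / r₁ ^ 4 * |s - s'| := by
      rw [norm_mul]
      have hinv : (((s : ℝ) : ℂ))⁻¹ - (((s' : ℝ) : ℂ))⁻¹ = (((s' - s : ℝ) : ℂ)) / ((((s : ℝ) : ℂ)) * ((s' : ℝ) : ℂ)) := by
        field_simp; push_cast; ring
      rw [hinv, norm_div, norm_mul, hnorm s hs0, hnorm s' hs'0, Complex.norm_real, Real.norm_eq_abs, abs_sub_comm]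
      calc ‖f s'‖ * (|s - s'| / (s * s')) ≤ Mf * (|s - s'| / (r₁ ^ 2 * r₁ ^ 2)) := by
            refine mul_le_mul (hbd s') ?_ (by positivity) hMf
            exact div_le_div_of_nonneg_left (abs_nonneg _) (by positivity) (mul_le_mul hs.le hs'.le hr2.le hs0.le)
        _ = Mf / r₁ ^ 4 * |s - s'| := by ring
    calc _ ≤ ‖(f s - f s') / ((s : ℝ) : ℂ)‖ + ‖f s' * ((((s : ℝ) : ℂ))⁻¹ - (((s' : ℝ) : ℂ))⁻¹)‖ := norm_add_le _ _
      _ ≤ Lf / r₁ ^ 2 * |s - s'| + Mf / r₁ ^ 4 * |s - s'| := add_le_add hA hB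
      _ = (Lf / r₁ ^ 2 + Mf / r₁ ^ 4) * |s - s'| := by ring

/-- **The propagator of the shell weight `f`**: `(f(s)/s)·(ik₀+e) = f(s)·(−ik₀+e)⁻¹`, `s = k₀² + e²`. -/
theorem klsp_div_propagator_eq (f : ℝ → ℂ) (k₀ e : ℝ) :
    f (k₀ ^ 2 + e ^ 2) / (((k₀ ^ 2 + e ^ 2 : ℝ)) : ℂ) * (I * k₀ + e) = f (k₀ ^ 2 + e ^ 2) * (-I * k₀ + e)⁻¹ := by
  rw [klsp_propagator_eq (fun s => f s / ((s : ℝ) : ℂ)) k₀ e]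
  by_cases hz : ((k₀ ^ 2 + e ^ 2 : ℝ) : ℂ) = 0
  · have hz' : k₀ ^ 2 + e ^ 2 = 0 := by exact_mod_cast hz
    have hk : k₀ = 0 := by nlinarith [sq_nonneg k₀, sq_nonneg e]
    have he : e = 0 := by nlinarith [sq_nonneg k₀, sq_nonneg e]
    subst hk; subst he
    simp
  · rw [div_mul_cancel₀ _ hz]

/-- **Sharp sup bound of the slice propagator**: `‖f(s)·(−ik₀+e)⁻¹‖ = ‖f(s)‖/√s ≤ M_f/r₁` (`f = 0` for `s ≤ r₁²`, `r₁ > 0`), in the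
singularity-free form `‖(f(s)/s)·(ik₀+e)‖ ≤ M_f/r₁`. -/
theorem klsp_div_propagator_norm_le (hbd : ∀ s, ‖f s‖ ≤ Mf) (hin : ∀ s, s ≤ r₁ ^ 2 → f s = 0) (hr₁ : 0 < r₁) (k₀ e : ℝ) :
    ‖f (k₀ ^ 2 + e ^ 2) / (((k₀ ^ 2 + e ^ 2 : ℝ)) : ℂ) * (I * k₀ + e)‖ ≤ Mf / r₁ := by
  have hMf : 0 ≤ Mf := (norm_nonneg _).trans (hbd 0)
  set s : ℝ := k₀ ^ 2 + e ^ 2 with hs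
  rcases le_or_gt s (r₁ ^ 2) with h | h
  · rw [hin s h, zero_div, zero_mul, norm_zero]; positivity
  · have hs0 : 0 < s := lt_trans (by positivity) h
    have hsq : r₁ < Real.sqrt s := by
      rw [show r₁ = Real.sqrt (r₁ ^ 2) by rw [Real.sqrt_sq hr₁.le]]
      exact Real.sqrt_lt_sqrt (by positivity) h
    rw [norm_mul, norm_div, Complex.norm_real, Real.norm_of_nonneg hs0.le, klzd_norm_lin, ← hs]
    calc ‖f s‖ / s * Real.sqrt s = ‖f s‖ * (Real.sqrt s / s) := by ring
      _ = ‖f s‖ / Real.sqrt s := by rw [Real.sqrt_div_self, div_eq_mul_inv]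
      _ ≤ Mf / r₁ := div_le_div₀ hMf (hbd s) hr₁ hsq.le

end Weight

/-! ## §2 The scale form at `n ≤ n_β + 1` -/

section ScaleForm

variable {f f' : ℝ → ℂ} {Mf Lf' Mf' ℓ' : ℝ} {W : ℝ → ℂ} {δ : ℝ → ℝ} {BW δmax : ℝ}

/-- The frequency-count factor in scale form: `4Λ_n/π + 3/β ≤ (16/π)·Λ_n` for `n ≤ n_β + 1`, `β ≥ klBetaMin`. -/
theorem klsp_count_factor_le {β : ℝ} (hβ : klBetaMin ≤ β) {n : ℕ} (hn : n ≤ nScales β + 1) :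
    4 * klScale klE0 n / Real.pi + 3 / β ≤ 16 / Real.pi * klScale klE0 n := by
  have h := klte_pi_div_le_four_mul_klScale hβ hn
  have hβ0 : 0 < β := pos_of_klBetaMin_le hβ
  have h3 : 3 / β = (3 / Real.pi) * (Real.pi / β) := by field_simp
  rw [h3]
  have : (3 / Real.pi) * (Real.pi / β) ≤ (3 / Real.pi) * (4 * klScale klE0 n) :=
    mul_le_mul_of_nonneg_left h (by positivity)
  have heq : 4 * klScale klE0 n / Real.pi + 3 / Real.pi * (4 * klScale klE0 n) = 16 / Real.pi * klScale klE0 n := by ring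
  linarith

/-- **The transfer perturbation of the same-slice particle–hole bubble, in scale form.**  At scale `n ≤ n_β + 1` (`β ≥ klBetaMin`), with
`Λ = Λ_n`: the first line's shell weight `f : ℝ → ℂ` has `‖f‖ ≤ M_f` and `f(s) = 0` for `s ≤ (Λ/2)²` and for `s ≥ (4Λ)²`; the second line's
weight `f'` has `‖f'‖ ≤ M_f'`, is `L_f'`-Lipschitz with `L_f' ≤ ℓ'/Λ²`, and `f'(s) = 0` for `s ≤ (Λ/2)²` and for `s ≥ (4Λ)²`; the insertion
`W` has `‖W(e)‖ ≤ B_W` for `|e| < 4Λ`; the energy shift `|δ| ≤ δ_max`; `0 ≤ B_W, δ_max`; any `q₀`, any `M`.  Then, with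
`Φ(k₀,e) = (f(s)/s)(ik₀+e)`, `Ψ(k₀,e) = (f'(s)/s)(ik₀+e)` (`s = k₀²+e²`; the two slice propagators, `klsp_div_propagator_eq`):
`‖β⁻¹ • Σ_i ∫ W(e)·Φ(ω_i,e)·(Ψ(ω_i+q₀, e+δ(e)) − Ψ(ω_i,e)) de‖ ≤ (1024/π)·M_f·(48ℓ' + 193M_f')·B_W·(|q₀| + δ_max)/Λ_n`. -/
theorem klsp_slice_bubble_shift_norm_le (hbd : ∀ s, ‖f s‖ ≤ Mf) {n : ℕ}
    (hin : ∀ s, s ≤ (klScale klE0 n / 2) ^ 2 → f s = 0) (hout : ∀ s, (4 * klScale klE0 n) ^ 2 ≤ s → f s = 0)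
    (hlip' : ∀ s s', ‖f' s - f' s'‖ ≤ Lf' * |s - s'|) (hbd' : ∀ s, ‖f' s‖ ≤ Mf') (hLf' : Lf' ≤ ℓ' / klScale klE0 n ^ 2)
    (hin' : ∀ s, s ≤ (klScale klE0 n / 2) ^ 2 → f' s = 0) (hout' : ∀ s, (4 * klScale klE0 n) ^ 2 ≤ s → f' s = 0)
    (hBW : 0 ≤ BW) (hWbd : ∀ e, |e| < 4 * klScale klE0 n → ‖W e‖ ≤ BW) (hδ0 : 0 ≤ δmax) (hδ : ∀ e, |δ e| ≤ δmax)
    (q₀ : ℝ) {β : ℝ} (hβ : klBetaMin ≤ β) (hn : n ≤ nScales β + 1) (M : ℕ) :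
    ‖β⁻¹ • ∑ i : MatsubaraIdx M, ∫ e,
        W e * (f (matsubaraFreq β M i ^ 2 + e ^ 2) / (((matsubaraFreq β M i ^ 2 + e ^ 2 : ℝ)) : ℂ) * (I * (matsubaraFreq β M i) + e)) *
          (f' ((matsubaraFreq β M i + q₀) ^ 2 + (e + δ e) ^ 2) / ((((matsubaraFreq β M i + q₀) ^ 2 + (e + δ e) ^ 2 : ℝ)) : ℂ) *
              (I * ((matsubaraFreq β M i + q₀ : ℝ) : ℂ) + ((e + δ e : ℝ) : ℂ)) -
            f' (matsubaraFreq β M i ^ 2 + e ^ 2) / (((matsubaraFreq β M i ^ 2 + e ^ 2 : ℝ)) : ℂ) * (I * (matsubaraFreq β M i) + e))‖ ≤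
      1024 / Real.pi * Mf * (48 * ℓ' + 193 * Mf') * BW * (|q₀| + δmax) / klScale klE0 n := by
  set Λ := klScale klE0 n with hΛdef
  have hΛ : 0 < Λ := klth_klScale_pos n
  have hβ0 : 0 < β := pos_of_klBetaMin_le hβ
  have hMf : 0 ≤ Mf := (norm_nonneg _).trans (hbd 0)
  have hMf' : 0 ≤ Mf' := (norm_nonneg _).trans (hbd' 0)
  have hr₁ : 0 < Λ / 2 := by positivity
  have hr : 0 < 4 * Λ := by positivity
  have hLf'0 : 0 ≤ Lf' := by
    have := hlip' 0 1; have h0 : (0:ℝ) ≤ ‖f' 0 - f' 1‖ := norm_nonneg _; norm_num at this; linarith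
  have hℓ' : 0 ≤ ℓ' := by
    have : 0 ≤ ℓ' / Λ ^ 2 := hLf'0.trans hLf'
    rwa [le_div_iff₀ (by positivity), zero_mul] at this
  -- the second propagator in singularity-free form: `g' = f'/s`
  have hg'supp : ∀ s, (4 * Λ) ^ 2 ≤ s → (fun s : ℝ => f' s / ((s : ℝ) : ℂ)) s = 0 := fun s hs => by
    simp only [hout' s hs, zero_div]
  have hg'lip : ∀ s s', ‖(fun s : ℝ => f' s / ((s : ℝ) : ℂ)) s - (fun s : ℝ => f' s / ((s : ℝ) : ℂ)) s'‖ ≤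
      (Lf' / (Λ / 2) ^ 2 + Mf' / (Λ / 2) ^ 4) * |s - s'| := fun s s' =>
    klsp_div_lipschitz hlip' hbd' hin' hr₁ s s'
  have hg'bd : ∀ s, ‖(fun s : ℝ => f' s / ((s : ℝ) : ℂ)) s‖ ≤ Mf' / (Λ / 2) ^ 2 := fun s => klsp_div_norm_le hbd' hin' hr₁ s
  have hgsupp : ∀ s, (4 * Λ) ^ 2 ≤ s → (fun s : ℝ => f s / ((s : ℝ) : ℂ)) s = 0 := fun s hs => by
    simp only [hout s hs, zero_div]
  -- constants
  set A : ℝ := Mf / (Λ / 2) with hA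
  set K : ℝ := 3 * (Lf' / (Λ / 2) ^ 2 + Mf' / (Λ / 2) ^ 4) * (4 * Λ) ^ 2 + Mf' / (Λ / 2) ^ 2 with hK
  have hA0 : 0 ≤ A := by positivity
  have hK0 : 0 ≤ K := by positivity
  set D : ℝ := |q₀| + δmax with hD
  have hD0 : 0 ≤ D := by positivity
  -- the generic perturbation lemma with `Φ = Φ_{f/s}`, `Ψ = Φ_{f'/s}`
  have main := klsp_discrete_perturb_norm_le
    (Φ := fun k₀ e => f (k₀ ^ 2 + e ^ 2) / (((k₀ ^ 2 + e ^ 2 : ℝ)) : ℂ) * (I * k₀ + e))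
    (Ψ := fun k₀ e => f' (k₀ ^ 2 + e ^ 2) / (((k₀ ^ 2 + e ^ 2 : ℝ)) : ℂ) * (I * k₀ + e)) (W := W) (δ := δ)
    hA0 hK0 hBW hr.le hδ0
    (fun k₀ e => klsp_div_propagator_norm_le hbd hin hr₁ k₀ e)
    (fun k₀ hk e => klsp_zero_of_le_abs_fst hgsupp hr.le hk e)
    (fun k₀ e he => klsp_zero_of_le_abs_snd hgsupp hr.le k₀ he)
    (fun k₀ e k₀' e' => klsp_lipschitz hg'lip hg'bd hg'supp hr k₀ e k₀' e')
    hWbd hδ q₀ hβ0 M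
  refine main.trans ?_
  -- arithmetic
  have hcount := klsp_count_factor_le hβ hn
  rw [← hΛdef] at hcount
  have hKle : K ≤ (192 * ℓ' + 772 * Mf') / Λ ^ 2 := by
    have hKeq : K = 192 * Lf' + 772 * Mf' / Λ ^ 2 := by
      rw [hK]; field_simp; ring
    rw [hKeq, add_div]
    have : 192 * Lf' ≤ 192 * ℓ' / Λ ^ 2 := by rw [mul_div_assoc]; exact mul_le_mul_of_nonneg_left hLf' (by norm_num)
    linarith
  have hinner : 2 * (4 * Λ) * (BW * A * (K * D)) ≤ 2 * (4 * Λ) * (BW * A * ((192 * ℓ' + 772 * Mf') / Λ ^ 2 * D)) := by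
    have := mul_le_mul_of_nonneg_right hKle hD0
    have := mul_le_mul_of_nonneg_left this (show 0 ≤ BW * A by positivity)
    exact mul_le_mul_of_nonneg_left this (by positivity)
  calc (4 * Λ / Real.pi + 3 / β) * (2 * (4 * Λ) * (BW * A * (K * D)))
      ≤ (16 / Real.pi * Λ) * (2 * (4 * Λ) * (BW * A * ((192 * ℓ' + 772 * Mf') / Λ ^ 2 * D))) :=
        mul_le_mul hcount hinner (by positivity) (by positivity)
    _ = 1024 / Real.pi * Mf * (48 * ℓ' + 193 * Mf') * BW * D / Λ := by
        rw [hA]; field_simp; ring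

/-- **The same-slice particle–hole bubble AT TRANSFER `(q₀, δ)`, in scale form** = zero-transfer bubble (`klte_slice_bubble_weighted_norm_le`
applied to the weight product `F = f·f'`) + transfer perturbation (`klsp_slice_bubble_shift_norm_le`).  At scale `n ≤ n_β + 1` (`β ≥ klBetaMin`,
`Λ = Λ_n`): `f` (`‖f‖ ≤ M_f`, `L_f`-Lipschitz) and `f'` (`‖f'‖ ≤ M_f'`, `L_f'`-Lipschitz, `L_f' ≤ ℓ'/Λ²`) vanish for `s ≤ (Λ/2)²` and for
`s ≥ (4Λ)²`; the product `F = f·f'` has `‖F‖ ≤ M_F` (`0 ≤ M_F`) and is `L_F`-Lipschitz with `L_F ≤ ℓ_F/Λ²`; the insertion `W` is continuous with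
`‖W(e) − W(0)‖ ≤ L_W|e|` and `‖W(e)‖ ≤ B_W` for `|e| < 4Λ`; the shift `δ` is continuous with `|δ| ≤ δ_max`; `M ≥ β·4Λ/(2π) + 1`.  Then
`‖β⁻¹ • Σ_i ∫ W(e)·Φ(ω_i,e)·Ψ(ω_i+q₀, e+δ(e)) de‖ ≤ (524288/π)(ℓ_F + 8M_F)·L_W·Λ_n + (393216/π)(ℓ_F + 8M_F)·B_W·(π/β)/Λ_n
  + (1024/π)·M_f·(48ℓ' + 193M_f')·B_W·(|q₀| + δ_max)/Λ_n`
(zero-sound remainder + thermal term + transfer-Lipschitz term: the «below-resolution» branch of `phGainOf` with explicit crude constants). -/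
theorem klsp_slice_bubble_transfer_norm_le {Lf LF MF ℓF LW : ℝ}
    (hlip : ∀ s s', ‖f s - f s'‖ ≤ Lf * |s - s'|) (hbd : ∀ s, ‖f s‖ ≤ Mf) {n : ℕ}
    (hin : ∀ s, s ≤ (klScale klE0 n / 2) ^ 2 → f s = 0) (hout : ∀ s, (4 * klScale klE0 n) ^ 2 ≤ s → f s = 0)
    (hlip' : ∀ s s', ‖f' s - f' s'‖ ≤ Lf' * |s - s'|) (hbd' : ∀ s, ‖f' s‖ ≤ Mf') (hLf' : Lf' ≤ ℓ' / klScale klE0 n ^ 2)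
    (hin' : ∀ s, s ≤ (klScale klE0 n / 2) ^ 2 → f' s = 0) (hout' : ∀ s, (4 * klScale klE0 n) ^ 2 ≤ s → f' s = 0)
    (hMF : 0 ≤ MF) (hFlip : ∀ s s', ‖f s * f' s - f s' * f' s'‖ ≤ LF * |s - s'|) (hFbd : ∀ s, ‖f s * f' s‖ ≤ MF)
    (hLF : LF ≤ ℓF / klScale klE0 n ^ 2)
    (hW : Continuous W) (hLW : 0 ≤ LW) (hBW : 0 ≤ BW)
    (hWlip : ∀ e : ℝ, |e| < 4 * klScale klE0 n → ‖W e - W 0‖ ≤ LW * |e|)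
    (hWbd : ∀ e, |e| < 4 * klScale klE0 n → ‖W e‖ ≤ BW)
    (hδc : Continuous δ) (hδ0 : 0 ≤ δmax) (hδ : ∀ e, |δ e| ≤ δmax)
    (q₀ : ℝ) {β : ℝ} (hβ : klBetaMin ≤ β) (hn : n ≤ nScales β + 1) {M : ℕ}
    (hM : β * (4 * klScale klE0 n) / (2 * Real.pi) + 1 ≤ M) :
    ‖β⁻¹ • ∑ i : MatsubaraIdx M, ∫ e,
        W e * (f (matsubaraFreq β M i ^ 2 + e ^ 2) / (((matsubaraFreq β M i ^ 2 + e ^ 2 : ℝ)) : ℂ) * (I * (matsubaraFreq β M i) + e)) *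
          (f' ((matsubaraFreq β M i + q₀) ^ 2 + (e + δ e) ^ 2) / ((((matsubaraFreq β M i + q₀) ^ 2 + (e + δ e) ^ 2 : ℝ)) : ℂ) *
              (I * ((matsubaraFreq β M i + q₀ : ℝ) : ℂ) + ((e + δ e : ℝ) : ℂ)))‖ ≤
      524288 / Real.pi * (ℓF + 8 * MF) * LW * klScale klE0 n +
        393216 / Real.pi * (ℓF + 8 * MF) * BW * ((Real.pi / β) / klScale klE0 n) +
          1024 / Real.pi * Mf * (48 * ℓ' + 193 * Mf') * BW * (|q₀| + δmax) / klScale klE0 n := by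
  set Λ := klScale klE0 n with hΛdef
  have hΛ : 0 < Λ := klth_klScale_pos n
  have hβ0 : 0 < β := pos_of_klBetaMin_le hβ
  have hr₁ : 0 < Λ / 2 := by positivity
  have hr : 0 < 4 * Λ := by positivity
  set ω : MatsubaraIdx M → ℝ := fun i => matsubaraFreq β M i with hω
  -- names for the three integrand families
  set Φ : ℝ → ℝ → ℂ := fun k₀ e => f (k₀ ^ 2 + e ^ 2) / (((k₀ ^ 2 + e ^ 2 : ℝ)) : ℂ) * (I * k₀ + e) with hΦ
  set Ψ : ℝ → ℝ → ℂ := fun k₀ e => f' (k₀ ^ 2 + e ^ 2) / (((k₀ ^ 2 + e ^ 2 : ℝ)) : ℂ) * (I * k₀ + e) with hΨ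
  -- the singularity-free weights and their properties
  have hgsupp : ∀ s, (4 * Λ) ^ 2 ≤ s → (fun s : ℝ => f s / ((s : ℝ) : ℂ)) s = 0 := fun s hs => by
    simp only [hout s hs, zero_div]
  have hglip : ∀ s s', ‖(fun s : ℝ => f s / ((s : ℝ) : ℂ)) s - (fun s : ℝ => f s / ((s : ℝ) : ℂ)) s'‖ ≤
      (Lf / (Λ / 2) ^ 2 + Mf / (Λ / 2) ^ 4) * |s - s'| := fun s s' => klsp_div_lipschitz hlip hbd hin hr₁ s s'
  have hgbd : ∀ s, ‖(fun s : ℝ => f s / ((s : ℝ) : ℂ)) s‖ ≤ Mf / (Λ / 2) ^ 2 := fun s => klsp_div_norm_le hbd hin hr₁ s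
  have hg'supp : ∀ s, (4 * Λ) ^ 2 ≤ s → (fun s : ℝ => f' s / ((s : ℝ) : ℂ)) s = 0 := fun s hs => by
    simp only [hout' s hs, zero_div]
  have hg'lip : ∀ s s', ‖(fun s : ℝ => f' s / ((s : ℝ) : ℂ)) s - (fun s : ℝ => f' s / ((s : ℝ) : ℂ)) s'‖ ≤
      (Lf' / (Λ / 2) ^ 2 + Mf' / (Λ / 2) ^ 4) * |s - s'| := fun s s' => klsp_div_lipschitz hlip' hbd' hin' hr₁ s s'
  have hg'bd : ∀ s, ‖(fun s : ℝ => f' s / ((s : ℝ) : ℂ)) s‖ ≤ Mf' / (Λ / 2) ^ 2 := fun s => klsp_div_norm_le hbd' hin' hr₁ s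
  -- continuity in `e` of the factors
  have hΦc : ∀ k₀, Continuous fun e => Φ k₀ e := fun k₀ => klsp_continuous_snd hglip hgbd hgsupp hr k₀
  have hΨc : ∀ k₀, Continuous fun e => Ψ k₀ e := fun k₀ => klsp_continuous_snd hg'lip hg'bd hg'supp hr k₀
  have hΨsc : ∀ k₀, Continuous fun e => Ψ (k₀ + q₀) (e + δ e) := fun k₀ =>
    (hΨc (k₀ + q₀)).comp (continuous_id.add hδc)
  have hΦzero : ∀ k₀ e, 4 * Λ ≤ |e| → Φ k₀ e = 0 := fun k₀ e he => klsp_zero_of_le_abs_snd hgsupp hr.le k₀ he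
  -- integrability of the two pieces of each slice (continuous, supported in `[-4Λ, 4Λ]`)
  have hint1 : ∀ k₀ : ℝ, Integrable fun e : ℝ => W e * Φ k₀ e * Ψ k₀ e := by
    intro k₀
    have hcont : Continuous fun e : ℝ => W e * Φ k₀ e * Ψ k₀ e := (hW.mul (hΦc k₀)).mul (hΨc k₀)
    refine hcont.integrable_of_hasCompactSupport ?_
    refine HasCompactSupport.intro (isCompact_Icc (a := -(4 * Λ)) (b := 4 * Λ)) fun e he => ?_
    rw [hΦzero k₀ e (klsp_le_abs_of_not_mem_Icc he), mul_zero, zero_mul]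
  have hint2 : ∀ k₀ : ℝ, Integrable fun e : ℝ => W e * Φ k₀ e * (Ψ (k₀ + q₀) (e + δ e) - Ψ k₀ e) := by
    intro k₀
    have hcont : Continuous fun e : ℝ => W e * Φ k₀ e * (Ψ (k₀ + q₀) (e + δ e) - Ψ k₀ e) :=
      (hW.mul (hΦc k₀)).mul ((hΨsc k₀).sub (hΨc k₀))
    refine hcont.integrable_of_hasCompactSupport ?_
    refine HasCompactSupport.intro (isCompact_Icc (a := -(4 * Λ)) (b := 4 * Λ)) fun e he => ?_
    rw [hΦzero k₀ e (klsp_le_abs_of_not_mem_Icc he), mul_zero, zero_mul]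
  -- split each slice: `Ψ_shift = Ψ + (Ψ_shift − Ψ)`
  have hsplit : ∀ i : MatsubaraIdx M,
      (∫ e, W e * Φ (ω i) e * Ψ (ω i + q₀) (e + δ e)) =
        (∫ e, W e * Φ (ω i) e * Ψ (ω i) e) + ∫ e, W e * Φ (ω i) e * (Ψ (ω i + q₀) (e + δ e) - Ψ (ω i) e) := by
    intro i
    rw [← integral_add (hint1 (ω i)) (hint2 (ω i))]
    refine integral_congr_ae (Filter.Eventually.of_forall fun e => ?_)
    simp only
    ring
  -- the zero-transfer integrand in the carrier's form `F(s)((−ik₀+e)²)⁻¹ W(e)`, `F = f f'`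
  have hzero_form : ∀ (k₀ e : ℝ), W e * Φ k₀ e * Ψ k₀ e =
      (f (k₀ ^ 2 + e ^ 2) * f' (k₀ ^ 2 + e ^ 2)) * ((-I * k₀ + e) ^ 2)⁻¹ * W e := by
    intro k₀ e
    simp only [hΦ, hΨ]
    rw [klsp_div_propagator_eq f k₀ e, klsp_div_propagator_eq f' k₀ e]
    rw [show ((-I * (k₀ : ℂ) + e) ^ 2)⁻¹ = (-I * k₀ + e)⁻¹ * (-I * k₀ + e)⁻¹ by rw [sq, mul_inv]]
    ring
  -- assemble
  have hsum : (β⁻¹ • ∑ i : MatsubaraIdx M, ∫ e, W e * Φ (ω i) e * Ψ (ω i + q₀) (e + δ e)) =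
      β⁻¹ • (∑ i : MatsubaraIdx M, ∫ e, (f (ω i ^ 2 + e ^ 2) * f' (ω i ^ 2 + e ^ 2)) * ((-I * (ω i) + e) ^ 2)⁻¹ * W e) +
        β⁻¹ • ∑ i : MatsubaraIdx M, ∫ e, W e * Φ (ω i) e * (Ψ (ω i + q₀) (e + δ e) - Ψ (ω i) e) := by
    rw [← smul_add, ← Finset.sum_add_distrib]
    congr 1
    refine Finset.sum_congr rfl fun i _ => ?_
    rw [hsplit i]
    congr 1
    refine integral_congr_ae (Filter.Eventually.of_forall fun e => ?_)
    exact hzero_form (ω i) e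
  have h1 := klte_slice_bubble_weighted_norm_le (F := fun s => f s * f' s) (W := W) hMF hFlip hFbd hLF
    (fun s hs => by simp only [hin s hs, zero_mul]) (fun s hs => by simp only [hout s hs, zero_mul])
    hW hLW hBW hWlip hWbd hβ hn hM
  have h2 := klsp_slice_bubble_shift_norm_le hbd hin hout hlip' hbd' hLf' hin' hout' hBW hWbd hδ0 hδ q₀ hβ hn M
  change ‖β⁻¹ • ∑ i : MatsubaraIdx M, ∫ e, W e * Φ (ω i) e * Ψ (ω i + q₀) (e + δ e)‖ ≤ _
  rw [hsum]
  refine (norm_add_le _ _).trans ?_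
  exact add_le_add h1 h2

end ScaleForm

end Summit.HubbardSuperconductivity.HubbardSuperconductivity.Theorems.KLRegimeSplit

end
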